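import Summits.QuantumFields.YangMills.Theorems.UniversalDetectorMirrorPositivity
import Summits.QuantumFields.YangMills.Theorems.UniversalDetectorTorusPeriodicity
import Summits.QuantumFields.YangMills.Theorems.UniversalDetectorQ2Adapter

/-!
# Route `UniversalDetector`, support item `PlaneLimitExtraction` (stmt-QuantumFields-23251) — the hypotheses
`hM` / `hnear` of `tendsto_Q2_of_near_kernel` from (TIGHT) and the extraction clause

Ideator seat ym-idea-8 g7 (LINE 4 of rung R2a = `BalabanLadder.NT`).  The g4 adapter
`tendsto_Q2_of_near_kernel` (`UniversalDetectorQ2Adapter`) turns a uniform far bound (`hM`) and a near-kernel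
approximation in balls (`hnear`) for the PAIR kernel `s⁻⁸ Cov_T(dens x, dens x')` into
`Q2 β_k L_k s_k w₁ w₂ → ∫∫ w₁ w₂ K(y − x)`.  The route's data are stated for the ONE-POINT kernel
`s⁻⁸ Cov_T(dens 0, dens z)`, `z ∈ box 4 L` ((TIGHT) and the extraction clause of `PlaneLimitExtraction`).  This module
bridges the two for test functions carried by the time slabs `t₀ ≤ -x₀ ≤ T`, `t₀ ≤ x'₀ ≤ T`:

* `sub_mem_box_of_norm_le` — in a ball of radius `R` with `2R ≤ sL` the difference `x' - x` lies in `box 4 L`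
  (no wrap at all); `pairKernel_eq_of_mem_ball`;
* `pairKernel_eq_cRep` — in general `Cov_T(dens x, dens x') = Cov_T(dens 0, dens ẑ)` with `ẑ` the centred
  representative of `x' - x`, which for slab-supported pairs and `2T ≤ sL` keeps the time coordinate
  `x'₀ - x₀ ≥ 2t₀/s` (no time wrap), hence `2t₀ ≤ ‖s ẑ‖`;
* `Q2_farBound_of_tight` (`hM` with `M = C + C_K`) and `Q2_nearKernel_of_approx` (`hnear`).

No summit, rung or crux is proved here.
-/

set_option autoImplicit false

noncomputable section

open scoped SchwartzMap
open MeasureTheory Filter Topology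
open Literature.MathematicalPhysics.QuantumFieldTheory Literature.MathematicalPhysics.QuantumLattice
  Literature.Probability.LatticeModels
open Summit.QuantumFields.YangMills.Cruxes.OSLegsFromFemtoAndGap.DlrCollarTransfer

namespace Summit.QuantumFields.YangMills.Cruxes.UniversalDetectorPlaneTight

variable {G : Type} [Group G] [TopologicalSpace G] [IsTopologicalGroup G] [CompactSpace G]
  [MeasurableSpace G] [BorelSpace G] (r : LatticeRep G)

omit [Group G] [TopologicalSpace G] [IsTopologicalGroup G] [CompactSpace G] [MeasurableSpace G] [BorelSpace G] r in
/-- `s (x' - x) = s x' - s x` in `ℝ⁴`. -/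
theorem smul_siteToE_sub (s : ℝ) (x x' : Site 4) :
    s • siteToE (x' - x) = s • siteToE x' - s • siteToE x := by
  rw [← smul_sub]; congr 1; ext i; simp [siteToE_apply]

omit [Group G] [TopologicalSpace G] [IsTopologicalGroup G] [CompactSpace G] [MeasurableSpace G] [BorelSpace G] r in
/-- **No wrap in a ball.**  If `‖s x‖, ‖s x'‖ ≤ R` and `2R ≤ sL` (`s > 0`) then `x' - x ∈ box 4 L`. -/
theorem sub_mem_box_of_norm_le {s R : ℝ} (hs : 0 < s) {L : ℕ} (hRL : 2 * R ≤ s * L) {x x' : Site 4}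
    (hx : ‖s • siteToE x‖ ≤ R) (hx' : ‖s • siteToE x'‖ ≤ R) : x' - x ∈ box 4 L := by
  have key : ∀ (z : Site 4) (i : Fin 4), s * |(z i : ℝ)| ≤ ‖s • siteToE z‖ := fun z i => by
    rw [norm_smul, Real.norm_of_nonneg hs.le]
    exact mul_le_mul_of_nonneg_left
      (by simpa [siteToE_apply, Real.norm_eq_abs] using PiLp.norm_apply_le (siteToE z) i) hs.le
  rw [mem_box]
  intro i
  have h1 := (key x i).trans hx
  have h2 := (key x' i).trans hx'
  have h3 : s * |((x' - x : Site 4) i : ℝ)| ≤ s * L := by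
    rw [Pi.sub_apply, Int.cast_sub]
    calc s * |(x' i : ℝ) - x i| ≤ s * (|(x' i : ℝ)| + |(x i : ℝ)|) := by gcongr; exact abs_sub _ _
      _ ≤ 2 * R := by linarith
      _ ≤ s * L := hRL
  have h4 : |((x' - x : Site 4) i : ℝ)| ≤ L := le_of_mul_le_mul_left h3 hs
  have h5 : |(x' - x : Site 4) i| ≤ (L : ℤ) := by exact_mod_cast h4
  exact abs_le.1 h5

/-- **Pair kernel in a ball.**  With `x' - x ∈ box 4 L`: `Cov_T(dens x, dens x') = Cov_T(dens 0, dens (x' - x))`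
(translation invariance; no representative needed). -/
theorem pairKernel_eq_translate (β : ℝ) (L : ℕ) (x x' : Site 4) :
    torusE G r β L (fun U => dens G r x U * dens G r x' U) - torusE G r β L (dens G r x) * torusE G r β L (dens G r x') =
      torusE G r β L (fun U => dens G r 0 U * dens G r (x' - x) U) -
        torusE G r β L (dens G r 0) * torusE G r β L (dens G r (x' - x)) :=
  cov_dens_translate r β L x x'

/-- **Pair kernel at the centred representative.**  `Cov_T(dens x, dens x') = Cov_T(dens 0, dens ẑ)`,
`ẑ = cRep (x' - x) ∈ box 4 L`. -/
theorem pairKernel_eq_cRep (β : ℝ) (L : ℕ) (x x' : Site 4) :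
    torusE G r β L (fun U => dens G r x U * dens G r x' U) - torusE G r β L (dens G r x) * torusE G r β L (dens G r x') =
      torusE G r β L (fun U => dens G r 0 U * dens G r (Torus.cRep (Torus.proj (2 * L + 1) (x' - x))) U) -
        torusE G r β L (dens G r 0) * torusE G r β L (dens G r (Torus.cRep (Torus.proj (2 * L + 1) (x' - x)))) := by
  rw [cov_dens_translate r β L x x', cov_dens_cRep]

omit [Group G] [TopologicalSpace G] [IsTopologicalGroup G] [CompactSpace G] [MeasurableSpace G] [BorelSpace G] r in
/-- **No time wrap for slab-supported pairs.**  If `-T ≤ s x₀ ≤ -t₀` and `t₀ ≤ s x'₀ ≤ T` with `0 < t₀`, `0 < s`, `2T ≤ sL`, then the centred representative `ẑ` of `x' - x` has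
`ẑ₀ = x'₀ - x₀` and `2t₀ ≤ ‖s ẑ‖`. -/
theorem cRep_sub_time_of_slab {s t₀ T : ℝ} (hs : 0 < s) (ht₀ : 0 < t₀) {L : ℕ} (hTL : 2 * T ≤ s * L)
    {x x' : Site 4} (hx1 : -T ≤ s * (x 0 : ℝ)) (hx2 : s * (x 0 : ℝ) ≤ -t₀) (hx'1 : t₀ ≤ s * (x' 0 : ℝ))
    (hx'2 : s * (x' 0 : ℝ) ≤ T) :
    Torus.cRep (Torus.proj (2 * L + 1) (x' - x)) 0 = x' 0 - x 0 ∧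
      2 * t₀ ≤ ‖s • siteToE (Torus.cRep (Torus.proj (2 * L + 1) (x' - x)))‖ := by
  have key : ∀ (z : Site 4) (i : Fin 4), s * |(z i : ℝ)| ≤ ‖s • siteToE z‖ := fun z i => by
    rw [norm_smul, Real.norm_of_nonneg hs.le]
    exact mul_le_mul_of_nonneg_left
      (by simpa [siteToE_apply, Real.norm_eq_abs] using PiLp.norm_apply_le (siteToE z) i) hs.le
  have hle : s * ((x' 0 : ℝ) - x 0) ≤ s * L := by nlinarith
  have hzL : (x' 0 : ℝ) - x 0 ≤ L := le_of_mul_le_mul_left hle hs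
  have hz0 : 0 < (x' 0 : ℝ) - x 0 := by
    have : 0 < s * ((x' 0 : ℝ) - x 0) := by nlinarith
    exact pos_of_mul_pos_right this hs.le  -- `0 < s * t`, `0 ≤ s` ⇒ `0 < t`
  have hzLZ : x' 0 - x 0 ≤ (L : ℤ) := by exact_mod_cast hzL
  have hz0Z : 0 < x' 0 - x 0 := by exact_mod_cast hz0
  have hw : -(L : ℤ) ≤ (x' - x : Site 4) 0 ∧ (x' - x : Site 4) 0 ≤ L := by
    rw [Pi.sub_apply]; constructor <;> omega
  have ht : Torus.cRep (Torus.proj (2 * L + 1) (x' - x)) 0 = x' 0 - x 0 := by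
    rw [cRep_proj_apply_of_mem L (x' - x) 0 hw, Pi.sub_apply]
  refine ⟨ht, le_trans ?_ (key _ 0)⟩
  rw [ht]; push_cast
  rw [abs_of_pos hz0]
  nlinarith

omit [Group G] [TopologicalSpace G] [IsTopologicalGroup G] [CompactSpace G] [MeasurableSpace G] [BorelSpace G] r in
/-- Slab membership of a supported lattice point (`w (s x) ≠ 0`, `tsupport w ⊆ {t₀ ≤ ±y₀ ≤ T}`). -/
theorem slab_of_ne_zero {s t₀ T : ℝ} (w : 𝓢(EuclideanSpace ℝ (Fin 4), ℝ)) (σ : ℝ)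
    (hw : tsupport (w : EuclideanSpace ℝ (Fin 4) → ℝ) ⊆ {y | t₀ ≤ σ * y 0 ∧ σ * y 0 ≤ T}) {x : Site 4}
    (hx : w (s • siteToE x) ≠ 0) : t₀ ≤ σ * (s * (x 0 : ℝ)) ∧ σ * (s * (x 0 : ℝ)) ≤ T := by
  have hmem : s • siteToE x ∈ tsupport (w : EuclideanSpace ℝ (Fin 4) → ℝ) :=
    subset_tsupport _ (Function.mem_support.2 hx)
  have h := hw hmem
  simpa only [Set.mem_setOf_eq, PiLp.smul_apply, siteToE_apply, smul_eq_mul] using h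

/-- **`hM` of `tendsto_Q2_of_near_kernel` from the far bound of (TIGHT).**  Along a lattice sequence (`s_k > 0`,
`s_k L_k → ∞`), if eventually `|s_k⁻⁸ Cov_T(dens 0, dens z)| ≤ C` for all `z ∈ box 4 L_k` with `2t₀ ≤ ‖s_k z‖`, and
`|K| ≤ C_K` on `{2t₀ ≤ ‖·‖}`, then eventually, for all slab-supported pairs,
`|s_k⁻⁸ Cov_T(dens x, dens x') − K(s_k x' − s_k x)| ≤ C + C_K`. -/
theorem Q2_farBound_of_tight (w₁ w₂ : 𝓢(EuclideanSpace ℝ (Fin 4), ℝ)) (K : EuclideanSpace ℝ (Fin 4) → ℝ)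
    {t₀ T : ℝ} (ht₀ : 0 < t₀)
    (h₁ : tsupport (w₁ : EuclideanSpace ℝ (Fin 4) → ℝ) ⊆ {y | t₀ ≤ -(y 0) ∧ -(y 0) ≤ T})
    (h₂ : tsupport (w₂ : EuclideanSpace ℝ (Fin 4) → ℝ) ⊆ {y | t₀ ≤ y 0 ∧ y 0 ≤ T})
    {C_K : ℝ} (hKb : ∀ z : EuclideanSpace ℝ (Fin 4), 2 * t₀ ≤ ‖z‖ → |K z| ≤ C_K)
    (β : ℕ → ℝ) (L : ℕ → ℕ) (s : ℕ → ℝ) (hs : ∀ k, 0 < s k)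
    (hL : Tendsto (fun k => s k * L k) atTop atTop) {C : ℝ}
    (hTb : ∀ᶠ k in atTop, ∀ z ∈ box 4 (L k), 2 * t₀ ≤ ‖s k • siteToE z‖ →
      |(s k)⁻¹ ^ 8 * (torusE G r (β k) (L k) (fun U => dens G r 0 U * dens G r z U) -
        torusE G r (β k) (L k) (dens G r 0) * torusE G r (β k) (L k) (dens G r z))| ≤ C) :
    ∀ᶠ k in atTop, ∀ x ∈ box 4 (L k), ∀ x' ∈ box 4 (L k),
      w₁ (s k • siteToE x) ≠ 0 → w₂ (s k • siteToE x') ≠ 0 →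
      |(s k)⁻¹ ^ 8 * (torusE G r (β k) (L k) (fun U => dens G r x U * dens G r x' U)
          - torusE G r (β k) (L k) (dens G r x) * torusE G r (β k) (L k) (dens G r x'))
        - K (s k • siteToE x' - s k • siteToE x)| ≤ C + C_K := by
  filter_upwards [hTb, hL.eventually_ge_atTop (2 * T)] with k hk hkL x hx x' hx' hw₁ hw₂
  have key : ∀ (z : Site 4) (i : Fin 4), s k * |(z i : ℝ)| ≤ ‖s k • siteToE z‖ := fun z i => by
    rw [norm_smul, Real.norm_of_nonneg (hs k).le]
    exact mul_le_mul_of_nonneg_left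
      (by simpa [siteToE_apply, Real.norm_eq_abs] using PiLp.norm_apply_le (siteToE z) i) (hs k).le
  have hsx := slab_of_ne_zero w₁ (-1) (by simpa using h₁) hw₁
  have hsx' := slab_of_ne_zero w₂ 1 (by simpa using h₂) hw₂
  simp only [neg_mul, one_mul] at hsx hsx'
  obtain ⟨ht, hn⟩ := cRep_sub_time_of_slab (hs k) ht₀ hkL (x := x) (x' := x') (by linarith) (by linarith)
    hsx'.1 hsx'.2
  rw [pairKernel_eq_cRep]
  have hb1 := hk _ (cRep_proj_mem_box (L k) (x' - x)) hn
  -- the continuum argument is `2t₀`-separated too (time component `s(x'₀ - x₀) ≥ 2t₀`)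
  have hfar : 2 * t₀ ≤ ‖s k • siteToE x' - s k • siteToE x‖ := by
    rw [← smul_siteToE_sub]
    refine le_trans ?_ (key (x' - x) 0)
    rw [Pi.sub_apply]; push_cast
    rw [abs_of_pos (by nlinarith [hs k])]
    nlinarith
  have hb2 := hKb _ hfar
  calc _ ≤ |(s k)⁻¹ ^ 8 * (torusE G r (β k) (L k) (fun U => dens G r 0 U *
              dens G r (Torus.cRep (Torus.proj (2 * L k + 1) (x' - x))) U) -
            torusE G r (β k) (L k) (dens G r 0) *
              torusE G r (β k) (L k) (dens G r (Torus.cRep (Torus.proj (2 * L k + 1) (x' - x)))))| +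
          |K (s k • siteToE x' - s k • siteToE x)| := abs_sub _ _
    _ ≤ C + C_K := add_le_add hb1 hb2

/-- **`hnear` of `tendsto_Q2_of_near_kernel` from the extraction clause.**  Along a lattice sequence (`s_k > 0`,
`s_k L_k → ∞`), if the one-point kernels approximate `K` locally uniformly on every annulus (the extraction clause of
`PlaneLimitExtraction`, with the subsequence already composed in), then for all `R, ε > 0`, eventually, for all
slab-supported pairs in the ball of radius `R`, `|s_k⁻⁸ Cov_T(dens x, dens x') − K(s_k x' − s_k x)| ≤ ε`. -/
theorem Q2_nearKernel_of_approx (w₁ w₂ : 𝓢(EuclideanSpace ℝ (Fin 4), ℝ)) (K : EuclideanSpace ℝ (Fin 4) → ℝ)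
    {t₀ T : ℝ} (ht₀ : 0 < t₀)
    (h₁ : tsupport (w₁ : EuclideanSpace ℝ (Fin 4) → ℝ) ⊆ {y | t₀ ≤ -(y 0) ∧ -(y 0) ≤ T})
    (h₂ : tsupport (w₂ : EuclideanSpace ℝ (Fin 4) → ℝ) ⊆ {y | t₀ ≤ y 0 ∧ y 0 ≤ T})
    (β : ℕ → ℝ) (L : ℕ → ℕ) (s : ℕ → ℝ) (hs : ∀ k, 0 < s k)
    (hL : Tendsto (fun k => s k * L k) atTop atTop)
    (happ : ∀ η ε : ℝ, 0 < η → 0 < ε → ∃ k₀ : ℕ, ∀ k : ℕ, k₀ ≤ k → ∀ z ∈ box 4 (L k),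
      η ≤ ‖s k • siteToE z‖ → ‖s k • siteToE z‖ ≤ η⁻¹ →
        |(s k)⁻¹ ^ 8 * (torusE G r (β k) (L k) (fun U => dens G r 0 U * dens G r z U) -
            torusE G r (β k) (L k) (dens G r 0) * torusE G r (β k) (L k) (dens G r z)) - K (s k • siteToE z)| ≤ ε) :
    ∀ R ε : ℝ, 0 < R → 0 < ε → ∀ᶠ k in atTop, ∀ x ∈ box 4 (L k), ∀ x' ∈ box 4 (L k),
      ‖s k • siteToE x‖ ≤ R → ‖s k • siteToE x'‖ ≤ R →
      w₁ (s k • siteToE x) ≠ 0 → w₂ (s k • siteToE x') ≠ 0 →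
      |(s k)⁻¹ ^ 8 * (torusE G r (β k) (L k) (fun U => dens G r x U * dens G r x' U)
          - torusE G r (β k) (L k) (dens G r x) * torusE G r (β k) (L k) (dens G r x'))
        - K (s k • siteToE x' - s k • siteToE x)| ≤ ε := by
  intro R ε hR hε
  -- annulus `η ≤ ‖s (x' - x)‖ ≤ η⁻¹` with `η = min (2t₀) (2R)⁻¹`
  set η : ℝ := min (2 * t₀) (2 * R)⁻¹ with hηdef
  have hη : 0 < η := by positivity
  obtain ⟨k₀, hk₀⟩ := happ η ε hη hε
  filter_upwards [eventually_ge_atTop k₀, hL.eventually_ge_atTop (2 * R)] with k hk hkL x hx x' hx' hxR hx'R hw₁ hw₂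
  have key : ∀ (z : Site 4) (i : Fin 4), s k * |(z i : ℝ)| ≤ ‖s k • siteToE z‖ := fun z i => by
    rw [norm_smul, Real.norm_of_nonneg (hs k).le]
    exact mul_le_mul_of_nonneg_left
      (by simpa [siteToE_apply, Real.norm_eq_abs] using PiLp.norm_apply_le (siteToE z) i) (hs k).le
  have hsx := slab_of_ne_zero w₁ (-1) (by simpa using h₁) hw₁
  have hsx' := slab_of_ne_zero w₂ 1 (by simpa using h₂) hw₂
  simp only [neg_mul, one_mul] at hsx hsx'
  have hmem : x' - x ∈ box 4 (L k) := sub_mem_box_of_norm_le (hs k) hkL hxR hx'R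
  rw [pairKernel_eq_translate, ← smul_siteToE_sub]
  refine hk₀ k hk (x' - x) hmem ?_ ?_
  · refine (min_le_left _ _).trans (le_trans ?_ (key (x' - x) 0))
    rw [Pi.sub_apply]; push_cast
    rw [abs_of_pos (by nlinarith [hs k])]
    nlinarith
  · have h2R : ‖s k • siteToE (x' - x)‖ ≤ 2 * R := by
      rw [smul_siteToE_sub]
      exact (norm_sub_le _ _).trans (by linarith)
    refine h2R.trans ?_
    rw [← le_inv_comm₀ hη (by positivity), hηdef]
    exact min_le_right _ _

end Summit.QuantumFields.YangMills.Cruxes.UniversalDetectorPlaneTight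

end
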